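import Summits.BirchSwinnertonDyer.BirchSwinnertonDyer.Theorems.EisensteinPrimesIndexPlumbingDictionary
import HarnessLib

/-!
# Crux `GoodLatticeBDPValue` (stmt-BirchSwinnertonDyer-19032), line `halves` v20.1, stub `stub_indexPlumbing`:
# the ARITHMETIC SHELL — the `λ`-identity from the mid-level corank identity, the non-primitive-versus-strict
# comparisons at `v̄` (as hypotheses) and the dictionaries (p648073)

Width seat bsd-line-x1-p1-w5 (gen 0, 2026-08-28). `stub_indexPlumbing` (v20.1, a012386a…) concludes
`λ(𝔛^{Sf}_f) + ε = λ(DSsub.X) + λ(DSquot.X)` from the mid-level identity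
`zpCorank R(E_K[p^∞]) + ε = zpCorank R((F/𝒪)(θsub)) + zpCorank R((F/𝒪)(θquot)) + p^c` (`hmid`, the conclusion of
`ResidualIndexAssembly.zpCorank_datumStrictSelmer_add_eq`, `R(·)` = the STRICT groups `datumStrictSelmer … (bdpData … vbar) ↑Sf`)
plus item (B) — non-primitive versus strict at `v̄`: `zpCorank S_nr(θsub) = zpCorank R(θsub)` (`(F/𝒪)(ω̃)^{I} = 0`) and
`zpCorank S_nr(θquot) = zpCorank R(θquot) + p^c` (`𝟙̃|_{D_v̄} = 𝟙`, SUR, one copy of `F/𝒪` per place above `v̄`) — plus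
item (C), the dictionaries `λ(𝔛^{Sf}_f) = zpCorank R(E_K[p^∞])`, `λ(DS.X) = zpCorank S_nr(θ)` (landed:
`IndexPlumbingDictionary`, p648073). This file is the shell: (B) enters as the two hypotheses `hBsub`, `hBquot` in the
Greenberg–Vatsal currency (`KellerYin2024.unrSelmer/grSelmer` are `datumSelmerInfty/datumStrictSelmer … (bdpData … vbar)`
by `rfl`), (C) is discharged, and the conclusion follows by linear arithmetic over `ℕ`. With seat w8's (B1)/(B2) files the
LEAD's `stub_indexPlumbing` is `shell ∘ (B1) ∘ (B2)`.

* `lambdaIdentity_of_mid_of_nrVsStrict` — binders: the crux's `W p K hK vbar hvbar κ γ θsub θquot Sf hSf`, the dual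
  data `DSsub DSquot`, abstract `e c : ℕ` (instantiate `e := [θquot = 𝟙]`), `hmid`, `hBsub`, `hBquot`, and the nine
  cotorsion facts in the order of the stub (`Module.Finite/IsTorsion/μ = 0` for `XAc`, `DSsub.X`, `DSquot.X`).

No new definition, no named fact, no `sorry`; no statement of the crux / KY Thm. 1.4.1 is proved here (the two (B)
hypotheses are open inputs of the line, seat w8).

References: T. Keller, M. Yin, arXiv:2402.12781v2, Thm. 1.4.1 (iii) and §1.4 (TeX L1087–1098, L1240–1260);
R. Greenberg, V. Vatsal, Invent. Math. 142 (2000), §2 p. 21.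
-/

-- D-0017: single-problem summit, the namespace repeats the problem name by design.
set_option linter.dupNamespace false
set_option autoImplicit false

noncomputable section

open scoped Classical

open NumberField IsDedekindDomain Field
open Literature.NumberTheory.EllipticCurves Literature.NumberTheory.EllipticCurves.GreenbergSelmer
  Literature.NumberTheory.EllipticCurves.GreenbergVatsal2000 Literature.NumberTheory.GaloisRepresentations
  Literature.NumberTheory.EllipticCurves.Castella2018 IsDedekindDomain.HeightOneSpectrum

namespace Summit.BirchSwinnertonDyer.BirchSwinnertonDyer.Theorems.IndexPlumbingShell

open Summit.BirchSwinnertonDyer.BirchSwinnertonDyer.Theorems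
  Summit.BirchSwinnertonDyer.BirchSwinnertonDyer.Theorems.IndexPlumbingDictionary

/-- **The arithmetic shell of `stub_indexPlumbing`.** At the crux's data (`E_K = W.baseChange K`, `K` imaginary
quadratic, `vbar ∋ p`, `Sf = {w ∣ N_W}`, dual data `DSsub`, `DSquot` of the non-primitive groups of the residual pair):
IF `zpCorank R(E_K[p^∞]) + e = zpCorank R(θsub) + zpCorank R(θquot) + p^c` (the mid-level identity), the non-primitive
groups compare to the strict ones as `zpCorank S_nr(θsub) = zpCorank R(θsub)` and
`zpCorank S_nr(θquot) = zpCorank R(θquot) + p^c`, and the three duals are finitely generated torsion with `μ = 0`, THEN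
`λ(𝔛^{Sf}_f) + e = λ(DSsub.X) + λ(DSquot.X)` — by the dictionaries `λ(𝔛^{Sf}_f) = zpCorank R(E_K[p^∞])`
(`finite_torsionBy_and_lambdaInvariant_XAc_eq_zpCorank_datumStrictSelmer`) and `λ(DS.X) = zpCorank S_nr(θ)`
(`finite_torsionBy_and_lambdaInvariant_datumDualData_charModule_eq_zpCorank`) and cancellation of `p^c`.
[cite: KellerYin2024, Thm. 1.4.1 (iii) and §1.4 (arXiv:2402.12781v2 TeX L1087–1098, L1240–1260)]
[cite: GreenbergVatsal2000, §2 p. 21] -/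
theorem lambdaIdentity_of_mid_of_nrVsStrict (W : WeierstrassCurve ℚ) [W.IsElliptic] (p : ℕ) [Fact p.Prime]
    (K : Type) [Field K] [NumberField K] (hK : IsImaginaryQuadratic K) (vbar : HeightOneSpectrum (𝓞 K))
    (hvbar : ((p : ℕ) : 𝓞 K) ∈ vbar.asIdeal) (κ : ZpExtension K p) (γ : absoluteGaloisGroup K)
    [Fact (κ.IsTopGenerator γ)] (θsub θquot : FramedGaloisRep K (padicCoeffIntegers (∅ : Set (PadicAlgCl p))) 1)
    (Sf : Finset (HeightOneSpectrum (𝓞 K)))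
    (hSf : ∀ w : HeightOneSpectrum (𝓞 K), w ∈ Sf ↔ ((W.conductorNorm ℤ : ℤ) : 𝓞 K) ∈ w.asIdeal)
    (DSsub : DatumDualData κ γ (KellerYin2024.charModule ∅ θsub)
      (AcSelmer.bdpData (KellerYin2024.charModule ∅ θsub) p vbar) (↑Sf : Set (HeightOneSpectrum (𝓞 K))))
    (DSquot : DatumDualData κ γ (KellerYin2024.charModule ∅ θquot)
      (AcSelmer.bdpData (KellerYin2024.charModule ∅ θquot) p vbar) (↑Sf : Set (HeightOneSpectrum (𝓞 K))))
    (e c : ℕ)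
    (hmid : zpCorank (datumStrictSelmer κ.kerSubgroup ↥((W.baseChange K).geomPrimaryTorsion p) p
          (AcSelmer.bdpData ↥((W.baseChange K).geomPrimaryTorsion p) p vbar) (↑Sf : Set (HeightOneSpectrum (𝓞 K)))) p + e =
        zpCorank (datumStrictSelmer κ.kerSubgroup (KellerYin2024.charModule ∅ θsub) p
            (AcSelmer.bdpData (KellerYin2024.charModule ∅ θsub) p vbar) (↑Sf : Set (HeightOneSpectrum (𝓞 K)))) p +
          zpCorank (datumStrictSelmer κ.kerSubgroup (KellerYin2024.charModule ∅ θquot) p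
            (AcSelmer.bdpData (KellerYin2024.charModule ∅ θquot) p vbar) (↑Sf : Set (HeightOneSpectrum (𝓞 K)))) p +
          p ^ c)
    (hBsub : zpCorank (datumSelmerInfty κ (KellerYin2024.charModule ∅ θsub)
          (AcSelmer.bdpData (KellerYin2024.charModule ∅ θsub) p vbar) (↑Sf : Set (HeightOneSpectrum (𝓞 K)))) p =
        zpCorank (datumStrictSelmer κ.kerSubgroup (KellerYin2024.charModule ∅ θsub) p
          (AcSelmer.bdpData (KellerYin2024.charModule ∅ θsub) p vbar) (↑Sf : Set (HeightOneSpectrum (𝓞 K)))) p)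
    (hBquot : zpCorank (datumSelmerInfty κ (KellerYin2024.charModule ∅ θquot)
          (AcSelmer.bdpData (KellerYin2024.charModule ∅ θquot) p vbar) (↑Sf : Set (HeightOneSpectrum (𝓞 K)))) p =
        zpCorank (datumStrictSelmer κ.kerSubgroup (KellerYin2024.charModule ∅ θquot) p
          (AcSelmer.bdpData (KellerYin2024.charModule ∅ θquot) p vbar) (↑Sf : Set (HeightOneSpectrum (𝓞 K)))) p + p ^ c)
    (hfgS : Module.Finite (IwasawaAlgebra p)
      (AcSelmer.XAc (W.baseChange K) p κ vbar (↑Sf : Set (HeightOneSpectrum (𝓞 K))) γ))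
    (htorS : Module.IsTorsion (IwasawaAlgebra p)
      (AcSelmer.XAc (W.baseChange K) p κ vbar (↑Sf : Set (HeightOneSpectrum (𝓞 K))) γ))
    (hμS : muInvariant p (AcSelmer.XAc (W.baseChange K) p κ vbar (↑Sf : Set (HeightOneSpectrum (𝓞 K))) γ) = 0)
    (hfgSsub : Module.Finite (IwasawaAlgebra p) DSsub.X) (htorSsub : Module.IsTorsion (IwasawaAlgebra p) DSsub.X)
    (hμSsub : muInvariant p DSsub.X = 0)
    (hfgSquot : Module.Finite (IwasawaAlgebra p) DSquot.X) (htorSquot : Module.IsTorsion (IwasawaAlgebra p) DSquot.X)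
    (hμSquot : muInvariant p DSquot.X = 0) :
    lambdaInvariant p (AcSelmer.XAc (W.baseChange K) p κ vbar (↑Sf : Set (HeightOneSpectrum (𝓞 K))) γ) + e =
      lambdaInvariant p DSsub.X + lambdaInvariant p DSquot.X := by
  haveI := hfgS
  haveI := hfgSsub
  haveI := hfgSquot
  rw [(finite_torsionBy_and_lambdaInvariant_XAc_eq_zpCorank_datumStrictSelmer W p K vbar κ Sf hK hvbar γ hSf
      htorS hμS).2,
    (finite_torsionBy_and_lambdaInvariant_datumDualData_charModule_eq_zpCorank p K vbar κ γ θsub _ DSsub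
      htorSsub hμSsub).2,
    (finite_torsionBy_and_lambdaInvariant_datumDualData_charModule_eq_zpCorank p K vbar κ γ θquot _ DSquot
      htorSquot hμSquot).2]
  omega

/-- **The INEQUALITY shell of `stub_indexPlumbing` (v20.1′, conclusion weakened to `≤` by the LEAD, 16:57Z):**
from the mid-level identity `zpCorank R(E_K[p^∞]) + e = zpCorank R(θsub) + zpCorank R(θquot) + p^c`, the `ω̃`-side
EQUALITY `zpCorank S_nr(θsub) = zpCorank R(θsub)` (`IndexPlumbingSubNrEqStrict`), the `𝟙̃`-side INEQUALITY in seat w8's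
`λ`-form `λ(DSquot.X) ≤ zpCorank R(θquot) + p^c` (`IndexPlumbingNrVsStrict.lambdaInvariant_le_zpCorank_grSelmer_add_pow_quot`;
`grSelmer` unfolds to `datumStrictSelmer (ker κ) … (bdpData … vbar)`), and the cotorsion facts of `𝔛^{Sf}_f` and `DSsub`:
`λ(DSsub.X) + λ(DSquot.X) ≤ λ(𝔛^{Sf}_f) + e` — by the dictionaries of p648073 and linear arithmetic. (Appended
2026-08-28; the `=` shell above is byte-identical.) [cite: KellerYin2024, Thm. 1.4.1 (iii) (arXiv:2402.12781v2 TeX L1087–1098)]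
[cite: GreenbergVatsal2000, §2 p. 21] -/
theorem lambdaLE_of_mid_of_nrEqStrict_of_le (W : WeierstrassCurve ℚ) [W.IsElliptic] (p : ℕ) [Fact p.Prime]
    (K : Type) [Field K] [NumberField K] (hK : IsImaginaryQuadratic K) (vbar : HeightOneSpectrum (𝓞 K))
    (hvbar : ((p : ℕ) : 𝓞 K) ∈ vbar.asIdeal) (κ : ZpExtension K p) (γ : absoluteGaloisGroup K)
    [Fact (κ.IsTopGenerator γ)] (θsub θquot : FramedGaloisRep K (padicCoeffIntegers (∅ : Set (PadicAlgCl p))) 1)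
    (Sf : Finset (HeightOneSpectrum (𝓞 K)))
    (hSf : ∀ w : HeightOneSpectrum (𝓞 K), w ∈ Sf ↔ ((W.conductorNorm ℤ : ℤ) : 𝓞 K) ∈ w.asIdeal)
    (DSsub : DatumDualData κ γ (KellerYin2024.charModule ∅ θsub)
      (AcSelmer.bdpData (KellerYin2024.charModule ∅ θsub) p vbar) (↑Sf : Set (HeightOneSpectrum (𝓞 K))))
    (DSquot : DatumDualData κ γ (KellerYin2024.charModule ∅ θquot)
      (AcSelmer.bdpData (KellerYin2024.charModule ∅ θquot) p vbar) (↑Sf : Set (HeightOneSpectrum (𝓞 K))))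
    (e c : ℕ)
    (hmid : zpCorank (datumStrictSelmer κ.kerSubgroup ↥((W.baseChange K).geomPrimaryTorsion p) p
          (AcSelmer.bdpData ↥((W.baseChange K).geomPrimaryTorsion p) p vbar) (↑Sf : Set (HeightOneSpectrum (𝓞 K)))) p + e =
        zpCorank (datumStrictSelmer κ.kerSubgroup (KellerYin2024.charModule ∅ θsub) p
            (AcSelmer.bdpData (KellerYin2024.charModule ∅ θsub) p vbar) (↑Sf : Set (HeightOneSpectrum (𝓞 K)))) p +
          zpCorank (datumStrictSelmer κ.kerSubgroup (KellerYin2024.charModule ∅ θquot) p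
            (AcSelmer.bdpData (KellerYin2024.charModule ∅ θquot) p vbar) (↑Sf : Set (HeightOneSpectrum (𝓞 K)))) p +
          p ^ c)
    (hBsub : zpCorank (datumSelmerInfty κ (KellerYin2024.charModule ∅ θsub)
          (AcSelmer.bdpData (KellerYin2024.charModule ∅ θsub) p vbar) (↑Sf : Set (HeightOneSpectrum (𝓞 K)))) p =
        zpCorank (datumStrictSelmer κ.kerSubgroup (KellerYin2024.charModule ∅ θsub) p
          (AcSelmer.bdpData (KellerYin2024.charModule ∅ θsub) p vbar) (↑Sf : Set (HeightOneSpectrum (𝓞 K)))) p)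
    (hBquot : lambdaInvariant p DSquot.X ≤
        zpCorank (datumStrictSelmer κ.kerSubgroup (KellerYin2024.charModule ∅ θquot) p
          (AcSelmer.bdpData (KellerYin2024.charModule ∅ θquot) p vbar) (↑Sf : Set (HeightOneSpectrum (𝓞 K)))) p + p ^ c)
    (hfgS : Module.Finite (IwasawaAlgebra p)
      (AcSelmer.XAc (W.baseChange K) p κ vbar (↑Sf : Set (HeightOneSpectrum (𝓞 K))) γ))
    (htorS : Module.IsTorsion (IwasawaAlgebra p)
      (AcSelmer.XAc (W.baseChange K) p κ vbar (↑Sf : Set (HeightOneSpectrum (𝓞 K))) γ))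
    (hμS : muInvariant p (AcSelmer.XAc (W.baseChange K) p κ vbar (↑Sf : Set (HeightOneSpectrum (𝓞 K))) γ) = 0)
    (hfgSsub : Module.Finite (IwasawaAlgebra p) DSsub.X) (htorSsub : Module.IsTorsion (IwasawaAlgebra p) DSsub.X)
    (hμSsub : muInvariant p DSsub.X = 0) :
    lambdaInvariant p DSsub.X + lambdaInvariant p DSquot.X ≤
      lambdaInvariant p (AcSelmer.XAc (W.baseChange K) p κ vbar (↑Sf : Set (HeightOneSpectrum (𝓞 K))) γ) + e := by
  haveI := hfgS
  haveI := hfgSsub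
  rw [(finite_torsionBy_and_lambdaInvariant_XAc_eq_zpCorank_datumStrictSelmer W p K vbar κ Sf hK hvbar γ hSf
      htorS hμS).2,
    (finite_torsionBy_and_lambdaInvariant_datumDualData_charModule_eq_zpCorank p K vbar κ γ θsub _ DSsub
      htorSsub hμSsub).2, hBsub]
  omega

end Summit.BirchSwinnertonDyer.BirchSwinnertonDyer.Theorems.IndexPlumbingShell

end
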